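/-
Copyright (c) 2026 the pub-hodgecm-mathlib formalisation cell (harness21).  Prover seat hodgecm-mathlib-A-p12 (g36): P6b wave B, the junction glue of
rows QB3 (2-I) (B-p04 (g53), ★ `AffineGroupSchemeActionCoaction`) and (2-II) (★ `FiniteFlatGroupSchemeQuotientAffineChart`) (DEALS v8, desk F0P6b-plan
(g14)), 2026-09-03.
-/
import Literature.AlgebraicGeometry.GroupSchemes.AffineGroupSchemeActionCoaction
import Literature.AlgebraicGeometry.GroupSchemes.FiniteFlatGroupSchemeQuotientAffineChart
import HarnessLib

/-!
# Quotient of an affine scheme by a free action of a finite locally free COMMUTATIVE group scheme: the affine chart exists (Mumford §12 Thm. 1, one chart)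

Topic `AlgebraicGeometry/GroupSchemes`; namespace `Literature.AlgebraicGeometry.GroupSchemes.FiniteFlatQuotientAffine.Chart`; THEOREMS ONLY.  Cell
`pub/hodgecm-mathlib` (D-0151), programme P6 «MOD», wave B of the P6b fan-out towards №1 §Q `stub_L4B1uQ_quotientByFiniteFlatSubgroup` (the `hchart`
slot of the charted-quotient datum, row (7)); lane `--supports stmt-HodgeConjecture-24832`; count-neutral.  HC_CM is proved only modulo the printed
citations (2 remaining named inputs hLiu418 = `stmt-HodgeConjecture-24832`, h413 = `stmt-HodgeConjecture-24833`) until rung 0 closes.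

THE THEOREM (`exists_chart_of_isFreeAction`; [MumfordAV1970] §12 Thm. 1 (A)+(B) pp. 111–114 for ONE affine chart, hypothesis-free form).  `R` Noetherian,
`G` an affine COMMUTATIVE group object of `Over (Spec R)` whose algebra `Γ(G)` is finite free over `R` (e.g. `G` finite flat over a local `R`, ★
`AffineGroupScheme.Alg.moduleFree_of_flat`), `U` an affine `G`-object of finite type over `R` on which `G` acts FREELY (★ `IsFreeAction`: Mumford's
`Ψ = (γ, pr_U)` a closed immersion).  Then there are an affine `R`-scheme `Q_U` of finite type and `q : U → Q_U` finite, flat, surjective with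
`γ ≫ q = pr_U ≫ q` and `G ×_R U ⇉ U → Q_U` cartesian.  PROOF = ★ (2-II) `Chart.exists_chart` fed with ★ (2-I)'s coaction `ρ := coaction G U` and its
laws: `lift_comap_comp_coaction` ((★ρ)), `coaction_coassoc` (this is where commutativity enters: sheet (A)'s coassociativity is the RIGHT-comodule
law), `coaction_counit`, `surjective_productMap_coaction` (freeness), `Alg.finiteType`.

## References
* [MumfordAV1970] D. Mumford, *Abelian Varieties* (1970), §12 Thm. 1 (pp. 111–114).
* [SGA3I] M. Demazure, A. Grothendieck (eds.), *SGA 3, Tome I*, Exp. V, Thm. 4.1 (ii), (iv).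
-/

set_option autoImplicit false

universe u

open CategoryTheory CategoryTheory.Limits AlgebraicGeometry MonoidalCategory CartesianMonoidalCategory

noncomputable section

namespace Literature.AlgebraicGeometry.GroupSchemes.FiniteFlatQuotientAffine.Chart

open scoped MonObj

open Literature.AlgebraicGeometry.Motives AffineGroupScheme

/-- **THE AFFINE CHART OF THE QUOTIENT BY A FREE ACTION EXISTS** ([MumfordAV1970] §12 Thm. 1 (A)+(B), one affine chart): for `R` Noetherian, `G`
affine commutative with `Γ(G)` finite free over `R`, `U` affine of finite type with a FREE `G`-action, there are `Q_U` affine of finite type over `R` and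
`q : U → Q_U` finite, flat, surjective, invariant (`γ ≫ q = pr_U ≫ q`), with `G ×_R U ⇉ U → Q_U` cartesian — ★ `Chart.exists_chart` at the coaction ★
`AffineGroupScheme.coaction G U` of the action. [cite: MumfordAV1970, §12 Thm. 1 (pp. 111–114)] [cite: SGA3I, Exp. V Thm. 4.1 (ii), (iv)] -/
theorem exists_chart_of_isFreeAction {R : Type u} [CommRing R] [IsNoetherianRing R] {G U : SchemeOver R} [GrpObj G] [IsCommMonObj G]
    [ModObj G U] [IsAffine G.left] [IsAffine U.left] [Module.Free R (Alg G)] [Module.Finite R (Alg G)] [LocallyOfFiniteType U.hom]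
    (hfree : IsFreeAction G U) :
    ∃ (QU : SchemeOver R) (q : U ⟶ QU), IsAffine QU.left ∧ LocallyOfFiniteType QU.hom ∧ IsFinite q.left ∧ Flat q.left ∧ Surjective q.left ∧
      γ[G, U] ≫ q = snd G U ≫ q ∧ IsPullback (γ[G, U]).left (snd G U).left q.left q.left :=
  haveI := Alg.finiteType U
  exists_chart (coaction G U) (lift_comap_comp_coaction G U) (coaction_coassoc G U) (coaction_counit G U)
    (surjective_productMap_coaction G U hfree)

end Literature.AlgebraicGeometry.GroupSchemes.FiniteFlatQuotientAffine.Chart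

end
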